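import Summits.MatrixMultiplication.OmegaCensus.ThreeSetLinePackedCorrelation
import Summits.MatrixMultiplication.OmegaCensus.ThreeSetLineFarkas
import HarnessLib

/-!
# Packed dual (Farkas) certificates for the three-set line identity: bignum correlations, `O(q)` list work per datum

ω-census `pub-omega`, family (b3), seat pub-omega-group gen 40.  Framing: lottery ticket; floor = certified bounds/negative
ranges.  VALUE: a reusable kernel TOOL for the three-set cube cells over `A ↠ ℤ_p²` (`(4,d,e)@p²`; the remaining cells
`(4,5,14)@841`, `(4,4,20)@961`, `(4,5,16)@961`); NOT progress on ω.  Companion of `ThreeSetLineFarkas` (list version).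

A killer line datum `(W, F)` is refuted by MODULAR DUAL VECTORS: `(m, z)` with `zᵀM ≡ 0 (mod m)` and, for each hole `s`,
`zᵀb_s ≢ 0 (mod m)` for some listed `(m, z)` (`M = lineMat3 W F`, the circulant-plus-Hankel matrix with symbols `A = acoef`,
`C = ccoef`; `b_s = K·𝟙 − e_s`).  Here every `Θ(q²)` list computation is replaced by ONE bignum product read through its
base-`X` digits — the **packed correlation** `Γ(z, a)(u) = Σ_r z(r)·a((r − u) mod q)`:
`enc z · enc (reverse a) = enc (lconv z (reverse a))` (`enc_lconv`), whose digit `q − 1 + u` plus digit `u − 1` is `Γ(z,a)(u)`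
(`gammaL_getD`, no carries as long as `Σz · Σa < X`).  Then
* `A(t) = Γ(F, W)(t) + Γ(W, F)(t)` (`acoefG_eq`),  `C(t) = Γ(W, reverse F)((t+1) mod q)` (`ccoefG_eq`),
* `(zᵀM)(u) = Γ(z, A)(u) + Γ(C, z)(u)` (`zMulG_getD`),  `zᵀb_s = K·Σz − z(s)` (`dot_bvec_eq_sub`).
`LineInv.farkasChkG q K X W F zs` runs these checks (with the no-carry bounds DECIDED inside the check) and
**`LineInv.farkasChkG_sound`** concludes that no `G : ZMod q → ℕ` and no hole satisfy the identity; `chunkChkG` /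
`chunkChkG_sound` / `forall_mem_of_chunks` (`ThreeSetLineFarkas`) assemble a window of `compsLit q d` against an aligned list of packed
certificates (`(m, enc m z)` pairs — each dual vector packed in base its own modulus) into the `hkill` shape of `ThreeSetZpCells4Core`.  Sign (positivity) certificates are not
included here (use `ThreeSetLineFarkas.farkasChk` or `noSol3ChkQ` for the rare integral data).
Measured (gen 40, `(4,4,11)@529`, `q = 23`, killer `{17,19,21,22}`, base `X = 2⁶⁴`): `0.05 s` of kernel time per `X`-datum
(`404` data in `23.5 s`, `101` in `8.1 s`) against `1.0 s` for `noSol3ChkQ` and `0.36 s` for the list version — the cell's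
`44 850` killer systems are ≈ `40 min` of kernel instead of ≈ `12 h`.  Certificates (generator `code/beta/farkas_gen.py` of the
seat: left kernels modulo the primes of the rational solution's denominators, then prime powers) exist for every datum tried.
USAGE NOTE: write certificate literals of more than ≈ 30 entries as `[…] ++ […] ++ …` (one long list literal becomes nested
`let`s on which `decide` times out while elaborating); reach deep windows of `compsLit` by NESTED drops of `≤ 20 000` each
(a single `List.drop n` with `n ≳ 28 000` exceeds the kernel's recursion depth, gen 39).
-/

namespace Summit.MatrixMultiplication.OmegaCensus

open Finset

namespace LineInv

/-! ## Packed symbols, packed `zᵀM`, and the check -/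

/-- Rotate left by one (`rot1 G (t) = G((t+1) mod q)`). [folklore] -/
def rot1 : List ℕ → List ℕ
  | [] => []
  | a :: l => l ++ [a]

/-- Packed circulant symbol `A = Γ(F, W) + Γ(W, F)` (pointwise, one pass). [folklore] -/
def acoefG (q X : ℕ) (W F : List ℕ) : List ℕ :=
  List.zipWith (· + ·) (gammaL q X F W) (gammaL q X W F)

/-- Packed Hankel symbol `C(t) = Γ(W, reverse F)((t + 1) mod q)` (a rotation by one). [folklore] -/
def ccoefG (q X : ℕ) (W F : List ℕ) : List ℕ :=
  rot1 (gammaL q X W F.reverse)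

/-- Packed `zᵀM = Γ(z, A) + Γ(C, z)` (pointwise, one pass). [folklore] -/
def zMulG (q X : ℕ) (A C z : List ℕ) : List ℕ :=
  List.zipWith (· + ·) (gammaL q X z A) (gammaL q X C z)

/-- Base-`X` digits `0 … q-1` of `n`. [folklore] -/
def unpackG (q X n : ℕ) : List ℕ := (List.range q).map fun j => digit X n j

/-- Hole coverage of one dual vector: position `s` is `true` iff `K·Σz − z(s) ≢ 0 (mod m)`. [folklore] -/
def coverG (K m : ℕ) (z : List ℕ) : List Bool :=
  let S := z.sum
  z.map fun v => !((K * S - v) % m == 0)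

/-- Pointwise `or` of a list of Boolean lists onto a base list. [folklore] -/
def orLists : List (List Bool) → List Bool → List Bool
  | [], base => base
  | L :: Ls, base => List.zipWith (· || ·) L (orLists Ls base)

/-- **The packed dual-certificate check** for the line data `(W, F)` over `ℤ_q` at fibre size `K` with packed certificates
`(m, enc m z)`: lengths and no-carry bounds, `zᵀM ≡ 0 (mod m)` for every listed vector, and every hole `s < q` refuted by
some listed vector (`K·Σz − z(s) ≢ 0 (mod m)`).  All list work is `O(q)` per vector. [folklore] -/
def farkasChkG (q K X : ℕ) (W F : List ℕ) (zs : List (ℕ × ℕ)) : Bool :=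
  let A := acoefG q X W F
  let C := ccoefG q X W F
  let Z := zs.map fun mz => (mz.1, unpackG q mz.1 mz.2)
  decide (0 < q) && decide (1 ≤ K) && decide (W.length = q) && decide (F.length = q) &&
  decide (W.sum * F.sum < X) &&
  (Z.all fun mz => decide (mz.2.sum * A.sum < X) && decide (C.sum * mz.2.sum < X) &&
    decide (mz.2.getD 0 0 ≤ K * mz.2.sum) &&
    (zMulG q X A C mz.2).all fun v => v % mz.1 == 0) &&
  (orLists (Z.map fun mz => coverG K mz.1 mz.2) (List.replicate q false)).all id

/-- A window of `X`-data against an aligned list of packed certificates. [folklore] -/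
def chunkChkG (q K X : ℕ) (W : List ℕ) (Fs : List (List ℕ)) (cs : List (List (ℕ × ℕ))) : Bool :=
  decide (Fs.length ≤ cs.length) && (List.zipWith (fun F c => farkasChkG q K X W F c) Fs cs).all id

/-! ## One-pass list plumbing -/

/-- Entries of a pointwise sum of two lists of length `q`. [folklore] -/
theorem getD_zipWith_add {u v : List ℕ} {q : ℕ} (hu : u.length = q) (hv : v.length = q) (t : ℕ) (ht : t < q) :
    (List.zipWith (· + ·) u v).getD t 0 = u.getD t 0 + v.getD t 0 := by
  have h1 : t < (List.zipWith (· + ·) u v).length := by rw [List.length_zipWith, hu, hv, min_self]; exact ht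
  rw [List.getD_eq_getElem _ _ h1, List.getElem_zipWith, List.getD_eq_getElem _ _ (by rw [hu]; exact ht),
    List.getD_eq_getElem _ _ (by rw [hv]; exact ht)]

/-- The length of a pointwise sum. [folklore] -/
theorem length_zipWith_add {u v : List ℕ} {q : ℕ} (hu : u.length = q) (hv : v.length = q) :
    (List.zipWith (· + ·) u v).length = q := by rw [List.length_zipWith, hu, hv, min_self]

/-- `rot1` is rotation by one. [folklore] -/
theorem rot1_eq_rotate (l : List ℕ) : rot1 l = l.rotate 1 := by
  cases l with
  | nil => simp [rot1]
  | cons a l => simp [rot1]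

/-- Entries of `rot1` of a list of length `q`. [folklore] -/
theorem rot1_getD {G : List ℕ} {q : ℕ} (hG : G.length = q) (t : ℕ) (ht : t < q) :
    (rot1 G).getD t 0 = G.getD ((t + 1) % q) 0 := by
  rw [rot1_eq_rotate, List.getD_eq_getElem?_getD, List.getElem?_rotate (by rw [hG]; exact ht), hG,
    ← List.getD_eq_getElem?_getD]

/-- The length of `gammaL`. [folklore] -/
theorem length_gammaL (q X : ℕ) (z a : List ℕ) : (gammaL q X z a).length = q := by
  unfold gammaL; simp

/-- A `true` entry of a pointwise `or` comes from one side. [folklore] -/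
theorem getD_zipWith_or : ∀ (u v : List Bool) (s : ℕ),
    (List.zipWith (· || ·) u v).getD s false = true → u.getD s false = true ∨ v.getD s false = true
  | [], _, _, h => by simp at h
  | _ :: _, [], _, h => by simp at h
  | a :: u, b :: v, 0, h => by simpa using h
  | a :: u, b :: v, s + 1, h => by
    simp only [List.zipWith_cons_cons, List.getD_cons_succ] at h ⊢
    exact getD_zipWith_or u v s h

/-- A `true` entry of `orLists` comes from one of the lists. [folklore] -/
theorem exists_of_orLists : ∀ (Ls : List (List Bool)) (base : List Bool) (s : ℕ),
    (orLists Ls base).getD s false = true → base.getD s false = true ∨ ∃ L ∈ Ls, L.getD s false = true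
  | [], base, s, h => Or.inl h
  | L :: Ls, base, s, h => by
    unfold orLists at h
    rcases getD_zipWith_or _ _ _ h with h1 | h1
    · exact Or.inr ⟨L, by simp, h1⟩
    · rcases exists_of_orLists Ls base s h1 with h2 | ⟨L', hL', h2⟩
      · exact Or.inl h2
      · exact Or.inr ⟨L', by simp [hL'], h2⟩

/-- Reading the hole coverage list. [folklore] -/
theorem coverG_getD_true {K m : ℕ} {z : List ℕ} {s : ℕ} (h : (coverG K m z).getD s false = true) :
    (K * z.sum - z.getD s 0) % m ≠ 0 := by
  unfold coverG at h
  rw [List.getD_eq_getElem?_getD, List.getElem?_map] at h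
  cases hz : z[s]? with
  | none => rw [hz] at h; simp at h
  | some v =>
    rw [hz] at h
    simp only [Option.map_some, Option.getD_some, Bool.not_eq_true', beq_eq_false_iff_ne, ne_eq] at h
    rw [List.getD_eq_getElem?_getD, hz, Option.getD_some]
    exact h

/-- Two lists of length `q` with equal entries are equal. [folklore] -/
theorem ext_getD {u v : List ℕ} {q : ℕ} (hu : u.length = q) (hv : v.length = q)
    (h : ∀ t, t < q → u.getD t 0 = v.getD t 0) : u = v := by
  refine List.ext_getElem (by rw [hu, hv]) fun t h1 h2 => ?_
  have e := h t (by rw [← hu]; exact h1)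
  rwa [List.getD_eq_getElem _ _ h1, List.getD_eq_getElem _ _ h2] at e

/-! ## Correctness of the packed symbols -/

/-- `((v + t) mod q + q − t) mod q = v` for `v, t < q`. [folklore] -/
theorem shift_back (q v t : ℕ) (hv : v < q) (ht : t < q) : ((v + t) % q + q - t) % q = v := by
  rcases Nat.lt_or_ge (v + t) q with h | h
  · rw [Nat.mod_eq_of_lt h, show v + t + q - t = v + q by omega, Nat.add_mod_right, Nat.mod_eq_of_lt hv]
  · rw [show v + t = (v + t - q) + q by omega, Nat.add_mod_right, Nat.mod_eq_of_lt (by omega : v + t - q < q),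
      show v + t - q + q - t = v by omega, Nat.mod_eq_of_lt hv]

/-- **The packed circulant symbol is `acoef`.** [folklore] -/
theorem acoefG_eq {q X : ℕ} {W F : List ℕ} (hX : 0 < X) (hq : 0 < q) (hW : W.length = q) (hF : F.length = q)
    (hb : W.sum * F.sum < X) : acoefG q X W F = acoef q W F := by
  have hAl : (acoef q W F).length = q := by unfold acoef; simp
  refine ext_getD (length_zipWith_add (length_gammaL q X F W) (length_gammaL q X W F)) hAl fun t ht => ?_
  unfold acoefG
  rw [getD_zipWith_add (length_gammaL q X F W) (length_gammaL q X W F) t ht]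
  unfold acoef
  rw [getD_range_map _ ht, gammaL_getD hX hF hW (by rw [mul_comm]; exact hb) t ht, gammaL_getD hX hW hF hb t ht,
    sum_range_map, ← Finset.sum_add_distrib]
  -- first correlation: re-index `r = (v + t) mod q`
  have e1 : ∑ r ∈ Finset.range q, F.getD r 0 * W.getD ((r + q - t) % q) 0 =
      ∑ v ∈ Finset.range q, W.getD v 0 * F.getD ((t + v) % q) 0 := by
    rw [← sum_range_mod_shift q t hq (fun r => F.getD r 0 * W.getD ((r + q - t) % q) 0)]
    refine Finset.sum_congr rfl fun v hv => ?_
    rw [Finset.mem_range] at hv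
    rw [shift_back q v t hv ht, Nat.add_comm v t, mul_comm]
  rw [Finset.sum_add_distrib, e1, ← Finset.sum_add_distrib]
  refine Finset.sum_congr rfl fun v _ => ?_
  ring

/-- Index arithmetic for the packed Hankel symbol. [folklore] -/
theorem hank_indexG (q v t : ℕ) (hv : v < q) (ht : t < q) :
    (v + q - (t + 1) % q) % q < q ∧ q - 1 - (v + q - (t + 1) % q) % q = (t + q - v) % q := by
  have hq : 0 < q := by omega
  refine ⟨Nat.mod_lt _ hq, ?_⟩
  rcases Nat.lt_or_ge (t + 1) q with h1 | h1
  · rw [Nat.mod_eq_of_lt h1]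
    rcases Nat.lt_or_ge t v with h | h
    · rw [show v + q - (t + 1) = (v - t - 1) + q by omega, Nat.add_mod_right,
        Nat.mod_eq_of_lt (by omega : v - t - 1 < q), Nat.mod_eq_of_lt (by omega : t + q - v < q)]
      omega
    · rw [Nat.mod_eq_of_lt (by omega : v + q - (t + 1) < q), show t + q - v = (t - v) + q by omega,
        Nat.add_mod_right, Nat.mod_eq_of_lt (by omega : t - v < q)]
      omega
  · have ht' : t = q - 1 := by omega
    subst ht'
    rw [show q - 1 + 1 = q by omega, Nat.mod_self, Nat.sub_zero, Nat.add_mod_right, Nat.mod_eq_of_lt hv,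
      show q - 1 + q - v = (q - 1 - v) + q by omega, Nat.add_mod_right, Nat.mod_eq_of_lt (by omega : q - 1 - v < q)]

/-- **The packed Hankel symbol is `ccoef`.** [folklore] -/
theorem ccoefG_eq {q X : ℕ} {W F : List ℕ} (hX : 0 < X) (hq : 0 < q) (hW : W.length = q) (hF : F.length = q)
    (hb : W.sum * F.sum < X) : ccoefG q X W F = ccoef q W F := by
  have hCl : (ccoef q W F).length = q := by unfold ccoef; simp
  have hFr : F.reverse.length = q := by rw [List.length_reverse, hF]
  have hrl : (ccoefG q X W F).length = q := by
    unfold ccoefG; rw [rot1_eq_rotate, List.length_rotate, length_gammaL]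
  refine ext_getD hrl hCl fun t ht => ?_
  unfold ccoefG ccoef
  rw [rot1_getD (length_gammaL q X W F.reverse) t ht, getD_range_map _ ht,
    gammaL_getD hX hW hFr (by rw [List.sum_reverse]; exact hb) ((t + 1) % q) (Nat.mod_lt _ hq), sum_range_map]
  refine Finset.sum_congr rfl fun v hv => ?_
  rw [Finset.mem_range] at hv
  obtain ⟨hlt, hidx⟩ := hank_indexG q v t hv ht
  rw [getD_reverse_of_length hF _ hlt, hidx]

/-- **`zMulG` computes `zᵀM`**: `(zMulG q X A C z)(u) = Σ_{r<q} z(r)·mfun(r,u)` for `A = acoef`, `C = ccoef` (given the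
no-carry bounds). [folklore] -/
theorem zMulG_getD {q X : ℕ} {W F z : List ℕ} (hX : 0 < X) (hq : 0 < q) (hz : z.length = q)
    (hA : (acoef q W F).length = q) (hC : (ccoef q W F).length = q)
    (hb₁ : z.sum * (acoef q W F).sum < X) (hb₂ : (ccoef q W F).sum * z.sum < X) (u : ℕ) (hu : u < q) :
    (zMulG q X (acoef q W F) (ccoef q W F) z).getD u 0 = ∑ r ∈ Finset.range q, z.getD r 0 * mfun q W F r u := by
  unfold zMulG
  rw [getD_zipWith_add (length_gammaL _ _ _ _) (length_gammaL _ _ _ _) u hu, gammaL_getD hX hz hA hb₁ u hu,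
    gammaL_getD hX hC hz hb₂ u hu]
  have e2 : ∑ r ∈ Finset.range q, (ccoef q W F).getD r 0 * z.getD ((r + q - u) % q) 0 =
      ∑ v ∈ Finset.range q, z.getD v 0 * (ccoef q W F).getD ((v + u) % q) 0 := by
    rw [← sum_range_mod_shift q u hq (fun r => (ccoef q W F).getD r 0 * z.getD ((r + q - u) % q) 0)]
    refine Finset.sum_congr rfl fun v hv => ?_
    rw [Finset.mem_range] at hv
    rw [shift_back q v u hv hu, mul_comm]
  rw [e2, ← Finset.sum_add_distrib]
  refine Finset.sum_congr rfl fun r _ => ?_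
  unfold mfun
  ring

/-- `zᵀb_s = K·Σz − z(s)` for `z` of length `q`, `s < q`, `K ≥ 1`. [folklore] -/
theorem dot_bvec_eq_sub {q K s : ℕ} {z : List ℕ} (hz : z.length = q) (hs : s < q) (hK : 1 ≤ K) :
    dot z (bvec q K s) = K * z.sum - z.getD s 0 := by
  unfold bvec
  rw [dot_range_map, sum_eq_sum_getD z, hz, Finset.mul_sum]
  have h2 : ∑ r ∈ Finset.range q, z.getD r 0 * (if r = s then K - 1 else K) + z.getD s 0 =
      ∑ r ∈ Finset.range q, K * z.getD r 0 := by
    rw [← Finset.sum_erase_add _ _ (Finset.mem_range.2 hs), ← Finset.sum_erase_add (Finset.range q) _ (Finset.mem_range.2 hs),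
      if_pos rfl, add_assoc]
    congr 1
    · exact Finset.sum_congr rfl fun r hr => by rw [if_neg (Finset.ne_of_mem_erase hr)]; ring
    · obtain ⟨K', rfl⟩ : ∃ K', K = K' + 1 := ⟨K - 1, by omega⟩
      rw [Nat.add_sub_cancel]; ring
  omega

/-! ## Soundness -/

section Sound

variable {q : ℕ} [NeZero q]

/-- The length of `orLists` over lists of a common length. [folklore] -/
theorem length_orLists {q : ℕ} : ∀ (Ls : List (List Bool)) (base : List Bool), (∀ L ∈ Ls, L.length = q) →
    base.length = q → (orLists Ls base).length = q
  | [], base, _, hb => hb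
  | L :: Ls, base, hL, hb => by
    unfold orLists
    rw [List.length_zipWith, hL L (by simp), length_orLists Ls base (fun L' h' => hL L' (by simp [h'])) hb, min_self]

/-- **Soundness of the packed dual certificates.**  If `farkasChkG q K X W F zs` passes, then no `G : ZMod q → ℕ` and no
hole `s` satisfy the three-set line identity `Σ_u M(τ,u)·G(u) + [s = τ] = K` for the list data `W, F`. [folklore] -/
theorem farkasChkG_sound {K X : ℕ} {W F : List ℕ} {zs : List (ℕ × ℕ)} (h : farkasChkG q K X W F zs = true)
    (G : ZMod q → ℕ) (s : ZMod q)
    (hid : ∀ τ : ZMod q, (∑ u : ZMod q, lineMat3 (vecFn W) (vecFn F) τ u * G u) + (if s = τ then 1 else 0) = K) :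
    False := by
  unfold farkasChkG at h
  simp only [Bool.and_eq_true, decide_eq_true_eq] at h
  obtain ⟨⟨⟨⟨⟨⟨hq, hK⟩, hWl⟩, hFl⟩, hWF⟩, hzs⟩, hholes⟩ := h
  have hX : 0 < X := by omega
  have hAeq := acoefG_eq hX hq hWl hFl hWF
  have hCeq := ccoefG_eq hX hq hWl hFl hWF
  have hAl : (acoef q W F).length = q := by unfold acoef; simp
  have hCl : (ccoef q W F).length = q := by unfold ccoef; simp
  set Z := zs.map (fun mz => (mz.1, unpackG q mz.1 mz.2)) with hZ
  have hZlen : ∀ mz ∈ Z, mz.2.length = q := by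
    intro mz hmz
    rw [hZ, List.mem_map] at hmz
    obtain ⟨mz0, _, rfl⟩ := hmz
    unfold unpackG; simp
  -- the hole `s.val` is covered by some listed vector
  set OL := orLists (Z.map fun mz => coverG K mz.1 mz.2) (List.replicate q false) with hOL
  have hOLl : OL.length = q := by
    refine length_orLists _ _ (fun L hL => ?_) (List.length_replicate ..)
    rw [List.mem_map] at hL
    obtain ⟨mz, hmz, rfl⟩ := hL
    unfold coverG; rw [List.length_map]; exact hZlen mz hmz
  have hsl : s.val < OL.length := by rw [hOLl]; exact ZMod.val_lt s
  have hget : OL.getD s.val false = true := by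
    rw [List.all_eq_true] at hholes
    have hm : OL.getD s.val false ∈ OL := by
      rw [List.getD_eq_getElem?_getD, List.getElem?_eq_getElem hsl, Option.getD_some]; exact List.getElem_mem hsl
    exact hholes _ hm
  rcases exists_of_orLists _ _ _ hget with hbase | ⟨L, hL, hLs⟩
  · rw [List.getD_eq_getElem?_getD, List.getElem?_replicate] at hbase
    split_ifs at hbase <;> simp at hbase
  rw [List.mem_map] at hL
  obtain ⟨mz, hmz, rfl⟩ := hL
  have hne := coverG_getD_true hLs
  -- the checks for this vector
  rw [List.all_eq_true] at hzs
  have hc := hzs mz hmz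
  simp only [Bool.and_eq_true, decide_eq_true_eq] at hc
  obtain ⟨⟨⟨hb1, hb2⟩, _⟩, hzm⟩ := hc
  set z := mz.2 with hzdef
  have hzl : z.length = q := hZlen mz hmz
  rw [hAeq] at hb1 hzm
  rw [hCeq] at hb2 hzm
  apply hne
  -- `K·Σz − z(s) = zᵀb_s = Σ_u G(u)·(zᵀM)(u) ≡ 0 (mod m)`
  have hdot : K * z.sum - z.getD s.val 0 = ∑ u ∈ Finset.range q, G (u : ZMod q) *
      (zMulG q X (acoef q W F) (ccoef q W F) z).getD u 0 := by
    rw [← dot_bvec_eq_sub hzl (ZMod.val_lt s) hK]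
    unfold bvec
    rw [dot_range_map]
    have e1 : ∑ r ∈ Finset.range q, z.getD r 0 * (if r = s.val then K - 1 else K) =
        ∑ r ∈ Finset.range q, z.getD r 0 * ∑ u ∈ Finset.range q, mfun q W F r u * G (u : ZMod q) := by
      refine Finset.sum_congr rfl fun r hr => ?_
      rw [sys_of_identity G s hid r (Finset.mem_range.1 hr)]
      unfold bvec
      rw [getD_range_map _ (Finset.mem_range.1 hr)]
    rw [e1, Finset.sum_congr rfl fun r _ => Finset.mul_sum (Finset.range q) _ _, Finset.sum_comm]
    refine Finset.sum_congr rfl fun u hu => ?_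
    rw [zMulG_getD hX hq hzl hAl hCl hb1 hb2 u (Finset.mem_range.1 hu), Finset.mul_sum]
    exact Finset.sum_congr rfl fun r _ => by ring
  rw [hdot, Finset.sum_nat_mod, Finset.sum_eq_zero, Nat.zero_mod]
  intro u hu
  set L := zMulG q X (acoef q W F) (ccoef q W F) z with hL
  have hLl : L.length = q := by rw [hL]; unfold zMulG; exact length_zipWith_add (length_gammaL _ _ _ _) (length_gammaL _ _ _ _)
  have hul : u < L.length := by rw [hLl]; exact Finset.mem_range.1 hu
  have hmem : L.getD u 0 ∈ L := by
    rw [List.getD_eq_getElem?_getD, List.getElem?_eq_getElem hul, Option.getD_some]; exact List.getElem_mem hul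
  rw [List.all_eq_true] at hzm
  have h0 := hzm _ hmem
  rw [beq_iff_eq] at h0
  rw [Nat.mul_mod, h0, mul_zero, Nat.zero_mod]

/-- **Soundness of a packed certified chunk** (semantic shape of `hkill`, `ThreeSetZpCells4Core`; the bound on `G` is not
used). [folklore] -/
theorem chunkChkG_sound {K X e : ℕ} {W : List ℕ} {Fs : List (List ℕ)} {cs : List (List (ℕ × ℕ))}
    (h : chunkChkG q K X W Fs cs = true) :
    ∀ F ∈ Fs, ∀ (G : ZMod q → ℕ) (s : ZMod q), (∀ u, G u ≤ e) →
      ¬ ∀ τ : ZMod q, (∑ u : ZMod q, lineMat3 (vecFn W) (vecFn F) τ u * G u) + (if s = τ then 1 else 0) = K := by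
  unfold chunkChkG at h
  rw [Bool.and_eq_true, decide_eq_true_eq, List.all_eq_true] at h
  obtain ⟨hlen, hall⟩ := h
  intro F hF G s _ hid
  obtain ⟨i, hi, rfl⟩ := List.getElem_of_mem hF
  have hic : i < cs.length := lt_of_lt_of_le hi hlen
  have hz : (List.zipWith (fun F c => farkasChkG q K X W F c) Fs cs)[i]'(by
      rw [List.length_zipWith]; exact lt_min hi hic) = farkasChkG q K X W Fs[i] (cs[i]) :=
    List.getElem_zipWith
  have hmem := List.getElem_mem (l := List.zipWith (fun F c => farkasChkG q K X W F c) Fs cs)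
    (n := i) (by rw [List.length_zipWith]; exact lt_min hi hic)
  have htrue := hall _ hmem
  rw [hz] at htrue
  exact farkasChkG_sound (id htrue) G s hid

end Sound

end LineInv

end Summit.MatrixMultiplication.OmegaCensus
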